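import Mathlib
import HarnessLib
import Summits.Ventures.LatticeQCDFlow.Exactness.SelfTunedFlowChoiceBias

/-!
# LatticeQCDFlow / Exactness — LEARNING ON THE JOB, XIII: THE BIAS OF RETRAINING IS AT MOST HOW FAR THE FLOW MOVED — the flow sampler's
# kernel is Lipschitz in the flow's density against the target, so switching between two flows by ANY rule reading the configuration biases
# one step by at most `2·∫|u − u'| dπ = 4·TV(q, q')`

HONEST FRAMING: exact (Metropolis-corrected) sampling algorithms for lattice gauge theory;
figures of merit are autocorrelation/cost numbers at stated couplings and volumes; no
continuum-physics claim.

Venture `LatticeQCDFlow` (cell pub-lqcd), topic `Exactness`, FANOUT row 30 (lean-1 GEN-44, theme LEARNING ON THE JOB).  NEW WORK of the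
cell; no definition is introduced, nothing is cited as a fact.  Tree inputs: `IMHKernel`, `SelfTunedFlowChoiceBias` (`lintegral_apply_eq_of_invariant`).  The quantitative companion of
`SelfTunedFlowChoiceBias` (switching flows by the state is biased) and `AdaptationBiasBounds` §2 (bias ≤ size of the adaptation, for an
abstract set-wise size): here the size is the flow's own — the `L¹(π)` distance between the densities `u = dq/dπ = 1/w` of the two flows
against the target, i.e. twice their total-variation distance.  Printed counterpart NAMED ONLY: the Diminishing-Adaptation condition stated
in the proposal's total variation (Roberts–Rosenthal 2007; Holden–Hauge–Holden 2009 for adaptive independence samplers).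

## Setting
A probability target `π`; a flow sampler written against the TARGET: `K(x, B) = ∫_B min(u(x), u(y)) π(dy) + (1 − ∫ min(u(x), u(y)) π(dy))·1_B(x)`
with `u = dq/dπ` the flow's density against the target (`indepMH_eq_targetForm`: this IS `indepMH q w` with `u = 1/w`, since
`min(1, w(y)/w(x)) q(dy) = min(1/w(x), 1/w(y)) π(dy)`).  Two flows `u`, `u'`; their pointwise discrepancy
`δ(y) = (u(y) ∸ u'(y)) + (u'(y) ∸ u(y))` (`= |u − u'|`); `D = ∫ δ dπ` (`= ‖u − u'‖_{L¹(π)} = 2·TV(q, q')`).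

## Results (no `sorry`)
* §1 `indepMH_eq_targetForm` — the flow sampler in target form; `min_le_min_add_discrepancy` — `min(u x, u y) ≤ min(u' x, u' y) + δ(x) + δ(y)`.
* §2 **`targetForm_apply_le`** — THE KERNEL IS LIPSCHITZ IN THE FLOW: `K(x, B) ≤ K'(x, B) + δ(x) + D` for every `x` and measurable `B`
  (case `x ∉ B` directly; case `x ∈ B` through the complement, both kernels being Markov).
* §3 **`switchedFlow_bias_le`** — for ANY joint law `ρ` of (which flow is used, configuration) with configuration-marginal `π` — a switch by
  a region, a soft gate, a learned classifier — the next law satisfies `ρκ(B) ≤ π(B) + 2D` and `π(B) ≤ ρκ(B) + 2D`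
  (**`switchedFlow_bias_ge`**); **`switchedFlow_real_abs_le`** — `|ρκ(B) − π(B)| ≤ 2D = 4·TV(q, q')`.  Retraining that moves the flow
  little (in total variation) biases little, whatever triggers the switch; the `O(1)` witness of `SelfTunedFlowChoiceBias` uses two flows
  at total-variation distance `1/6`.
-/

namespace Summit.Ventures.LatticeQCDFlow.Exactness

open MeasureTheory ProbabilityTheory
open scoped _root_.ENNReal

variable {Ω : Type*} [MeasurableSpace Ω] {π : Measure Ω}

/-! ## §1 The flow sampler in target form -/

section TargetForm

variable {q : Measure Ω} [IsProbabilityMeasure q] {w : Ω → ℝ}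

/-- **THE FLOW SAMPLER AGAINST THE TARGET**: with `π = w·q`, `0 < w`: `indepMH q w (x, B) = ∫_B min(1/w(x), 1/w(y)) π(dy) + (1 − ∫ min(1/w(x), 1/w(y)) π(dy))·1_B(x)`
— the kernel depends on the flow only through `u = 1/w = dq/dπ`. [ours] -/
theorem indepMH_eq_targetForm (hw : Measurable w) (hw0 : ∀ x, 0 < w x) (hπ : π = q.withDensity fun y => ENNReal.ofReal (w y)) (x : Ω)
    {B : Set Ω} (hB : MeasurableSet B) :
    indepMH q w x B = ∫⁻ y in B, min (ENNReal.ofReal (w x)⁻¹) (ENNReal.ofReal (w y)⁻¹) ∂π +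
      (1 - ∫⁻ y, min (ENNReal.ofReal (w x)⁻¹) (ENNReal.ofReal (w y)⁻¹) ∂π) * B.indicator 1 x := by
  have hu : Measurable fun y => min (ENNReal.ofReal (w x)⁻¹) (ENNReal.ofReal (w y)⁻¹) :=
    measurable_const.min (hw.inv.ennreal_ofReal)
  have hpt : ∀ y, min (ENNReal.ofReal (w x)⁻¹) (ENNReal.ofReal (w y)⁻¹) * ENNReal.ofReal (w y) = imhAcceptE w x y := by
    intro y
    rw [imhAcceptE, imhAccept, ← ENNReal.ofReal_min,
      ← ENNReal.ofReal_mul (le_min (inv_nonneg.2 (hw0 x).le) (inv_nonneg.2 (hw0 y).le)), min_mul_of_nonneg _ _ (hw0 y).le,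
      inv_mul_eq_div, inv_mul_cancel₀ (hw0 y).ne', min_comm]
  have hset : ∀ {C : Set Ω}, MeasurableSet C →
      ∫⁻ y in C, min (ENNReal.ofReal (w x)⁻¹) (ENNReal.ofReal (w y)⁻¹) ∂π = ∫⁻ y in C, imhAcceptE w x y ∂q := by
    intro C hC
    rw [hπ, setLIntegral_withDensity_eq_setLIntegral_mul _ hw.ennreal_ofReal hu hC]
    exact setLIntegral_congr_fun hC (fun y _ => by rw [Pi.mul_apply, mul_comm, hpt y])
  rw [indepMH_apply hw x hB, hset hB, imhAcceptMass, ← Measure.restrict_univ (μ := π), hset MeasurableSet.univ, Measure.restrict_univ]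

end TargetForm

omit [MeasurableSpace Ω] in
/-- `min(a, b) ≤ min(a', b') + ((a ∸ a') + (a' ∸ a)) + ((b ∸ b') + (b' ∸ b))` in `ℝ≥0∞`. [ours, bookkeeping] -/
theorem min_le_min_add_discrepancy (a a' b b' : ℝ≥0∞) : min a b ≤ min a' b' + ((a - a') + (a' - a)) + ((b - b') + (b' - b)) := by
  have ha : a ≤ a' + (a - a') := le_tsub_add.trans_eq (add_comm _ _)
  have hb : b ≤ b' + (b - b') := le_tsub_add.trans_eq (add_comm _ _)
  rcases le_total a' b' with h | h
  · rw [min_eq_left h]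
    calc min a b ≤ a := min_le_left _ _
      _ ≤ a' + (a - a') := ha
      _ ≤ a' + ((a - a') + (a' - a)) := add_le_add le_rfl le_self_add
      _ ≤ a' + ((a - a') + (a' - a)) + ((b - b') + (b' - b)) := le_self_add
  · rw [min_eq_right h]
    calc min a b ≤ b := min_le_right _ _
      _ ≤ b' + (b - b') := hb
      _ ≤ b' + ((b - b') + (b' - b)) := add_le_add le_rfl le_self_add
      _ ≤ b' + ((a - a') + (a' - a)) + ((b - b') + (b' - b)) := by rw [add_assoc]; exact add_le_add le_rfl le_add_self

/-! ## §2 The kernel is Lipschitz in the flow -/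

section Lipschitz

variable [IsProbabilityMeasure π] {u u' : Ω → ℝ≥0∞}

/-- The off-diagonal part: `∫_C min(u x, u y) π(dy) ≤ ∫_C min(u' x, u' y) π(dy) + δ(x) + ∫ δ dπ`. [ours] -/
theorem setLIntegral_min_le (hu : Measurable u) (hu' : Measurable u') (x : Ω) (C : Set Ω) :
    ∫⁻ y in C, min (u x) (u y) ∂π ≤ ∫⁻ y in C, min (u' x) (u' y) ∂π + ((u x - u' x) + (u' x - u x)) +
      ∫⁻ y, (u y - u' y) + (u' y - u y) ∂π := by
  have hδ : Measurable fun y => (u y - u' y) + (u' y - u y) := (hu.sub hu').add (hu'.sub hu)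
  calc ∫⁻ y in C, min (u x) (u y) ∂π
      ≤ ∫⁻ y in C, min (u' x) (u' y) + ((u x - u' x) + (u' x - u x)) + ((u y - u' y) + (u' y - u y)) ∂π :=
        lintegral_mono fun y => min_le_min_add_discrepancy _ _ _ _
    _ = ∫⁻ y in C, min (u' x) (u' y) ∂π + ((u x - u' x) + (u' x - u x)) * π C + ∫⁻ y in C, (u y - u' y) + (u' y - u y) ∂π := by
        rw [lintegral_add_right _ hδ, lintegral_add_right _ measurable_const, setLIntegral_const]
    _ ≤ ∫⁻ y in C, min (u' x) (u' y) ∂π + ((u x - u' x) + (u' x - u x)) + ∫⁻ y, (u y - u' y) + (u' y - u y) ∂π := by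
        gcongr
        · exact (mul_le_mul' le_rfl prob_le_one).trans_eq (mul_one _)
        · exact Measure.restrict_le_self

/-- **THE FLOW SAMPLER'S KERNEL IS LIPSCHITZ IN THE FLOW**: for Markov kernels `K`, `K'` in target form with densities `u`, `u'`,
`K(x, B) ≤ K'(x, B) + δ(x) + ∫ δ dπ`, `δ = |u − u'|`. [ours] -/
theorem targetForm_apply_le (hu : Measurable u) (hu' : Measurable u') (K K' : Kernel Ω Ω) [IsMarkovKernel K] [IsMarkovKernel K']
    (hK : ∀ (x : Ω) {B : Set Ω}, MeasurableSet B →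
      K x B = ∫⁻ y in B, min (u x) (u y) ∂π + (1 - ∫⁻ y, min (u x) (u y) ∂π) * B.indicator 1 x)
    (hK' : ∀ (x : Ω) {B : Set Ω}, MeasurableSet B →
      K' x B = ∫⁻ y in B, min (u' x) (u' y) ∂π + (1 - ∫⁻ y, min (u' x) (u' y) ∂π) * B.indicator 1 x)
    (x : Ω) {B : Set Ω} (hB : MeasurableSet B) :
    K x B ≤ K' x B + (((u x - u' x) + (u' x - u x)) + ∫⁻ y, (u y - u' y) + (u' y - u y) ∂π) := by
  by_cases hx : x ∈ B
  · -- through the complement: `K(x, B) + ∫_{Bᶜ} min u = 1 = K'(x, B) + ∫_{Bᶜ} min u'`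
    have hc : ∀ (L : Kernel Ω Ω) [IsMarkovKernel L] (v : Ω → ℝ≥0∞),
        (∀ (x : Ω) {B : Set Ω}, MeasurableSet B → L x B = ∫⁻ y in B, min (v x) (v y) ∂π + (1 - ∫⁻ y, min (v x) (v y) ∂π) * B.indicator 1 x) →
        L x B + ∫⁻ y in Bᶜ, min (v x) (v y) ∂π = 1 := by
      intro L _ v hL
      have h1 : L x Bᶜ = ∫⁻ y in Bᶜ, min (v x) (v y) ∂π := by
        rw [hL x hB.compl, Set.indicator_of_notMem (Set.notMem_compl_iff.2 hx), mul_zero, add_zero]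
      rw [← h1, measure_add_measure_compl hB, measure_univ]
    have hfin : ∫⁻ y in Bᶜ, min (u x) (u y) ∂π ≠ ⊤ := by
      refine ne_top_of_le_ne_top ENNReal.one_ne_top ?_
      rw [← hc K u hK]; exact le_add_self
    have key : K x B + ∫⁻ y in Bᶜ, min (u x) (u y) ∂π ≤
        K' x B + (((u x - u' x) + (u' x - u x)) + ∫⁻ y, (u y - u' y) + (u' y - u y) ∂π) + ∫⁻ y in Bᶜ, min (u x) (u y) ∂π := by
      calc K x B + ∫⁻ y in Bᶜ, min (u x) (u y) ∂π = 1 := hc K u hK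
        _ = K' x B + ∫⁻ y in Bᶜ, min (u' x) (u' y) ∂π := (hc K' u' hK').symm
        _ ≤ K' x B + (∫⁻ y in Bᶜ, min (u x) (u y) ∂π + ((u' x - u x) + (u x - u' x)) +
              ∫⁻ y, (u' y - u y) + (u y - u' y) ∂π) := add_le_add le_rfl (setLIntegral_min_le hu' hu x Bᶜ)
        _ = K' x B + (((u x - u' x) + (u' x - u x)) + ∫⁻ y, (u y - u' y) + (u' y - u y) ∂π) + ∫⁻ y in Bᶜ, min (u x) (u y) ∂π := by
              simp_rw [add_comm (u' _ - u _) (u _ - u' _)]; ring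
    exact (ENNReal.add_le_add_iff_right hfin).1 key
  · rw [hK x hB, hK' x hB, Set.indicator_of_notMem hx, mul_zero, add_zero, mul_zero, add_zero, ← add_assoc]
    exact setLIntegral_min_le hu hu' x B

end Lipschitz

/-! ## §3 The bias of switching between two flows by the configuration -/

section Switch

variable [IsProbabilityMeasure π] {u u' : Ω → ℝ≥0∞} {H : Type*} [MeasurableSpace H]

/-- **UPPER BOUND**: an adapted update `κ` on `H × Ω` whose every section is within the pointwise-plus-integrated discrepancy of one
exact Markov kernel `P` (as two flow samplers are, §2), applied from any joint law `ρ` with configuration-marginal `π`: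
`ρκ(B) ≤ π(B) + 2·∫ δ dπ`. [ours] -/
theorem switchedFlow_bias_le (hu : Measurable u) (hu' : Measurable u') (κ : Kernel (H × Ω) Ω) (P : Kernel Ω Ω)
    (hP : Kernel.Invariant P π) (ρ : Measure (H × Ω)) (hmarg : ρ.map Prod.snd = π) {B : Set Ω} (hB : MeasurableSet B)
    (hclose : ∀ (h : H) (x : Ω), κ (h, x) B ≤ P x B + (((u x - u' x) + (u' x - u x)) + ∫⁻ y, (u y - u' y) + (u' y - u y) ∂π)) :
    (ρ.bind κ) B ≤ π B + 2 * ∫⁻ y, (u y - u' y) + (u' y - u y) ∂π := by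
  have hδ : Measurable fun y => (u y - u' y) + (u' y - u y) := (hu.sub hu').add (hu'.sub hu)
  have hPB : Measurable fun x => P x B := Kernel.measurable_coe P hB
  have hmarg' : ∀ {g : Ω → ℝ≥0∞}, Measurable g → ∫⁻ p, g p.2 ∂ρ = ∫⁻ x, g x ∂π := fun hg => by
    rw [← hmarg, lintegral_map hg measurable_snd]
  rw [Measure.bind_apply hB (Kernel.aemeasurable _)]
  calc ∫⁻ p, κ p B ∂ρ ≤ ∫⁻ p, P p.2 B + (((u p.2 - u' p.2) + (u' p.2 - u p.2)) + ∫⁻ y, (u y - u' y) + (u' y - u y) ∂π) ∂ρ :=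
        lintegral_mono fun p => by obtain ⟨h, x⟩ := p; exact hclose h x
    _ = ∫⁻ x, P x B + (((u x - u' x) + (u' x - u x)) + ∫⁻ y, (u y - u' y) + (u' y - u y) ∂π) ∂π :=
        hmarg' (hPB.add (hδ.add measurable_const))
    _ = π B + (∫⁻ y, (u y - u' y) + (u' y - u y) ∂π + ∫⁻ y, (u y - u' y) + (u' y - u y) ∂π) := by
        rw [lintegral_add_left hPB, lintegral_apply_eq_of_invariant P hP hB, lintegral_add_left hδ, lintegral_const, measure_univ,
          mul_one]
    _ = π B + 2 * ∫⁻ y, (u y - u' y) + (u' y - u y) ∂π := by rw [two_mul]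

/-- **LOWER BOUND**: symmetrically `π(B) ≤ ρκ(B) + 2·∫ δ dπ`. [ours] -/
theorem switchedFlow_bias_ge (hu : Measurable u) (hu' : Measurable u') (κ : Kernel (H × Ω) Ω) (P : Kernel Ω Ω)
    (hP : Kernel.Invariant P π) (ρ : Measure (H × Ω)) (hmarg : ρ.map Prod.snd = π) {B : Set Ω} (hB : MeasurableSet B)
    (hclose : ∀ (h : H) (x : Ω), P x B ≤ κ (h, x) B + (((u x - u' x) + (u' x - u x)) + ∫⁻ y, (u y - u' y) + (u' y - u y) ∂π)) :
    π B ≤ (ρ.bind κ) B + 2 * ∫⁻ y, (u y - u' y) + (u' y - u y) ∂π := by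
  have hδ : Measurable fun y => (u y - u' y) + (u' y - u y) := (hu.sub hu').add (hu'.sub hu)
  have hPB : Measurable fun x => P x B := Kernel.measurable_coe P hB
  have hmarg' : ∀ {g : Ω → ℝ≥0∞}, Measurable g → ∫⁻ p, g p.2 ∂ρ = ∫⁻ x, g x ∂π := fun hg => by
    rw [← hmarg, lintegral_map hg measurable_snd]
  rw [Measure.bind_apply hB (Kernel.aemeasurable _), ← lintegral_apply_eq_of_invariant P hP hB, ← hmarg' hPB]
  calc ∫⁻ p, P p.2 B ∂ρ ≤ ∫⁻ p, κ p B + (((u p.2 - u' p.2) + (u' p.2 - u p.2)) + ∫⁻ y, (u y - u' y) + (u' y - u y) ∂π) ∂ρ :=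
        lintegral_mono fun p => by obtain ⟨h, x⟩ := p; exact hclose h x
    _ = ∫⁻ p, κ p B ∂ρ + ∫⁻ p, ((u p.2 - u' p.2) + (u' p.2 - u p.2)) + ∫⁻ y, (u y - u' y) + (u' y - u y) ∂π ∂ρ :=
        lintegral_add_right _ (show Measurable (fun p : H × Ω => ((u p.2 - u' p.2) + (u' p.2 - u p.2)) +
          ∫⁻ y, (u y - u' y) + (u' y - u y) ∂π) from (hδ.comp measurable_snd).add measurable_const)
    _ = ∫⁻ p, κ p B ∂ρ + 2 * ∫⁻ y, (u y - u' y) + (u' y - u y) ∂π := by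
        have hδD : Measurable fun x => ((u x - u' x) + (u' x - u x)) + ∫⁻ y, (u y - u' y) + (u' y - u y) ∂π :=
          hδ.add measurable_const
        rw [hmarg' hδD, lintegral_add_left hδ, lintegral_const, measure_univ, mul_one, two_mul]

/-- **THE BIAS OF SWITCHING FLOWS BY THE CONFIGURATION IS AT MOST `2‖u − u'‖_{L¹(π)} = 4·TV(q, q')`**: two flow samplers `K₀`, `K₁` (target
form, densities `u`, `u'`, `K₁` exact), an adapted update using `K₁` or `K₀` section by section in ANY configuration-dependent way (`κ(h, x)`
is `K₀(x, ·)` or `K₁(x, ·)` for each `(h, x)`), any joint law with configuration-marginal `π`: `|ρκ(B) − π(B)| ≤ 2·∫ δ dπ`. [ours] -/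
theorem switchedFlow_real_abs_le (hu : Measurable u) (hu' : Measurable u') (K₀ K₁ : Kernel Ω Ω) [IsMarkovKernel K₀] [IsMarkovKernel K₁]
    (hK₀ : ∀ (x : Ω) {B : Set Ω}, MeasurableSet B →
      K₀ x B = ∫⁻ y in B, min (u x) (u y) ∂π + (1 - ∫⁻ y, min (u x) (u y) ∂π) * B.indicator 1 x)
    (hK₁ : ∀ (x : Ω) {B : Set Ω}, MeasurableSet B →
      K₁ x B = ∫⁻ y in B, min (u' x) (u' y) ∂π + (1 - ∫⁻ y, min (u' x) (u' y) ∂π) * B.indicator 1 x)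
    (hK₁inv : Kernel.Invariant K₁ π) (κ : Kernel (H × Ω) Ω) [IsMarkovKernel κ]
    (hκ : ∀ (h : H) (x : Ω), (∀ {B : Set Ω}, MeasurableSet B → κ (h, x) B = K₀ x B) ∨ (∀ {B : Set Ω}, MeasurableSet B → κ (h, x) B = K₁ x B))
    (ρ : Measure (H × Ω)) [IsProbabilityMeasure ρ] (hmarg : ρ.map Prod.snd = π) {B : Set Ω} (hB : MeasurableSet B)
    (hD : ∫⁻ y, (u y - u' y) + (u' y - u y) ∂π ≠ ⊤) :
    |(ρ.bind κ).real B - π.real B| ≤ 2 * (∫⁻ y, (u y - u' y) + (u' y - u y) ∂π).toReal := by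
  haveI : IsProbabilityMeasure (ρ.bind κ) := ⟨by rw [Measure.bind_apply MeasurableSet.univ (Kernel.aemeasurable _)]; simp⟩
  set D : ℝ≥0∞ := ∫⁻ y, (u y - u' y) + (u' y - u y) ∂π with hDdef
  -- every section is within `δ(x) + D` of `K₁`, in both directions
  have hup : ∀ (h : H) (x : Ω), κ (h, x) B ≤ K₁ x B + (((u x - u' x) + (u' x - u x)) + D) := by
    intro h x
    rcases hκ h x with h0 | h1
    · rw [h0 hB]; exact targetForm_apply_le hu hu' K₀ K₁ hK₀ hK₁ x hB
    · rw [h1 hB]; exact le_self_add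
  have hlo : ∀ (h : H) (x : Ω), K₁ x B ≤ κ (h, x) B + (((u x - u' x) + (u' x - u x)) + D) := by
    intro h x
    rcases hκ h x with h0 | h1
    · rw [h0 hB]
      have := targetForm_apply_le hu' hu K₁ K₀ hK₁ hK₀ x hB
      simp_rw [add_comm (u' _ - u _) (u _ - u' _)] at this
      exact this
    · rw [h1 hB]; exact le_self_add
  have h1 := switchedFlow_bias_le hu hu' κ K₁ hK₁inv ρ hmarg hB hup
  have h2 := switchedFlow_bias_ge hu hu' κ K₁ hK₁inv ρ hmarg hB hlo
  have h2D : 2 * D ≠ ⊤ := ENNReal.mul_ne_top (by norm_num) hD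
  have h1' := ENNReal.toReal_mono (ENNReal.add_ne_top.2 ⟨measure_ne_top _ _, h2D⟩) h1
  have h2' := ENNReal.toReal_mono (ENNReal.add_ne_top.2 ⟨measure_ne_top _ _, h2D⟩) h2
  rw [ENNReal.toReal_add (measure_ne_top _ _) h2D, ENNReal.toReal_mul] at h1' h2'
  simp only [ENNReal.toReal_ofNat] at h1' h2'
  rw [abs_le, measureReal_def, measureReal_def]
  constructor <;> linarith

end Switch

end Summit.Ventures.LatticeQCDFlow.Exactness
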